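import Literature.Analysis.Complex.RootsOfUnityComplementUniformization
import Literature.Analysis.Complex.PuncturedDiscSchwarz
import HarnessLib

/-!
# The conformal radius of `ℂ ∖ μ_N`: lower bound from one zero of the covering (symmetrization)

`Literature/Analysis/Complex/RootsOfUnityComplementRadiusSymmetrization.lean` — PROOF-ONLY (no
definition, no named fact). Brick B2 of the elementary route to Calegari–Dimitrov–Tang's Theorem 5.1.4
(the conformal radius `|F_N′(0)| = 16^{1/N}(1 + ζ(3)/(2N³) + …)` of `ℂ ∖ μ_N`, in the lower-bound form
`|F_N′(0)| ≥ 16^{1/N}(1 + A/N³)` used by their Proposition 3.0.1), recorded in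
`Summits/…/Cruxes/StarredOptimalManinUnitFiveSeven/Lines/cdt_thm1-radius-elementary-route-g39.md`:

★ `sixteen_le_pow_norm_deriv_mul_of_zero` — for every holomorphic covering `Φ : 𝔻 → {z | zᴺ ≠ 1}` with
`Φ(0) = 0` (the universal covering `F_N`, CDT Def. 5.1.2) and every NONZERO ZERO `z₁` of `Φ`:
  `16 ≤ ‖Φ′(0)‖ᴺ · g(‖z₁‖ᴺ)`,   `g(r) = 2 r log(1/r)/(1 − r²)` (`< 1`),
i.e. `‖Φ′(0)‖ ≥ 16^{1/N} · g(‖z₁‖ᴺ)^{−1/N}`.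

Proof. Let `F(t) = 16^{1/N}(λ(tᴺ)/16)^{1/N}` be the tree's competitor
(`ModularLambda.exists_root_cuspFunction_modularLambda`: holomorphic `𝔻 → ℂ ∖ μ_N`, `F(0) = 0`,
`F′(0) = 16^{1/N}`, and `F⁻¹(0) = {0}` because `λ ≠ 0` on `ℍ`). Lift it through the covering:
`Φ ∘ ω = F`, `ω(0) = 0` (`Complex.exists_discLift_of_isCoveringMap`), so `Φ′(0) ω′(0) = 16^{1/N}`.
The self-map `H = ωᴺ = tᴺ · (dslope ω 0)ᴺ` of the disc OMITS `z₁ᴺ`: `ω(t)ᴺ = z₁ᴺ` forces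
`ω(t) = ζ z₁` with `ζᴺ = 1`, hence `F(t) = Φ(ζ z₁) = ζ Φ(z₁) = 0` (rotation symmetry of the covering,
`apply_mul_eq_mul_apply_of_isCoveringMap_compl_rootsOfUnity`), so `t = 0` and `ζ z₁ = ω(0) = 0`,
absurd. The punctured-disc Schwarz lemma at order `N`
(`norm_le_of_mapsTo_ball_of_forall_ne_of_eq_pow_mul`) gives `‖ω′(0)‖ᴺ ≤ g(‖z₁‖ᴺ)`.

With a zero at depth `1 − |z₁| ≥ c/N²` (brick B3, the first ring of zeros of `F_N`; CDT locate them at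
`|z₁| = cos(π/2N)`), `g(‖z₁‖ᴺ) ≤ 1 − c²/(6N²)(1 − o(1))` and the bound is `16^{1/N}(1 + A/N³)`.

## References
* [CalegariDimitrovTang2025] F. Calegari, V. Dimitrov, Y. Tang, J. Amer. Math. Soc. 38 (2025),
  Theorem 5.1.4, Lemma 5.1.3, proof of Proposition 3.0.1.
* [Ahlfors1973] L. V. Ahlfors, *Conformal invariants*, §1-6 (punctured-disc Schwarz lemma).
-/

noncomputable section

open Set Metric Filter Real
open scoped Topology

namespace Literature.Analysis.Complex

open _root_.Complex

/-- **The competitor `F = 16^{1/N}(λ(tᴺ)/16)^{1/N}` vanishes only at the origin** (a repackaging of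
`ModularLambda.exists_root_cuspFunction_modularLambda` with `λ ≠ 0` on `ℍ`): for `N ≥ 1` there is
`F` holomorphic on the disc with `F(0) = 0`, `F′(0) = 16^{1/N}`, `F(𝔻) ⊆ {z | zᴺ ≠ 1}` and
`F(t) = 0 → t = 0`. [cite: CalegariDimitrovTang2025, §4.2 proof of Lemma 23] -/
theorem exists_competitor_compl_rootsOfUnity {N : ℕ} (hN : 0 < N) :
    ∃ F : ℂ → ℂ, DifferentiableOn ℂ F (ball (0 : ℂ) 1) ∧ F 0 = 0 ∧
      deriv F 0 = (((16 : ℝ) ^ ((N : ℝ)⁻¹) : ℝ) : ℂ) ∧ MapsTo F (ball (0 : ℂ) 1) {z : ℂ | z ^ N ≠ 1} ∧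
      ∀ t ∈ ball (0 : ℂ) 1, F t = 0 → t = 0 := by
  obtain ⟨Φ, hΦd, hΦ0, hΦ1, hpow, hne⟩ :=
    Literature.NumberTheory.Automorphic.ModularLambda.exists_root_cuspFunction_modularLambda hN
  have hN0 : (N : ℝ) ≠ 0 := by exact_mod_cast hN.ne'
  set r : ℝ := (16 : ℝ) ^ ((N : ℝ)⁻¹) with hr
  have hrpos : 0 < r := by positivity
  have hrN : r ^ N = 16 := by
    rw [hr, ← Real.rpow_natCast, ← Real.rpow_mul (by norm_num), inv_mul_cancel₀ hN0, Real.rpow_one]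
  have hcN : ((r : ℂ)) ^ N = 16 := by exact_mod_cast hrN
  refine ⟨fun z ↦ (r : ℂ) * Φ z, hΦd.const_mul _, by simp [hΦ0], ?_, ?_, ?_⟩
  · rw [deriv_const_mul _ (hΦd.differentiableAt (ball_mem_nhds (0 : ℂ) one_pos)), hΦ1, mul_one]
  · intro z hz
    show ((r : ℂ) * Φ z) ^ N ≠ 1
    intro h
    rw [mul_pow, hcN] at h
    exact hne z hz (by linear_combination (1 / 16 : ℂ) * h)
  · intro t ht h0
    have hΦt : Φ t = 0 := by
      rcases mul_eq_zero.mp h0 with h | h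
      · exact absurd (by exact_mod_cast h : r = 0) hrpos.ne'
      · exact h
    by_contra ht0
    have htN : t ^ N ≠ 0 := pow_ne_zero _ ht0
    have htNball : ‖t ^ N‖ < 1 := by
      rw [norm_pow]
      exact pow_lt_one₀ (norm_nonneg _) (by simpa using ht) hN.ne'
    have h1 := hpow t ht
    rw [hΦt, zero_pow hN.ne'] at h1
    exact Literature.NumberTheory.Automorphic.ModularLambda.cuspFunction_modularLambda_ne_zero
      htNball htN h1.symm

/-- ★ **Conformal radius of `ℂ ∖ μ_N` from one zero of the covering (CDT Thm 5.1.4, symmetrization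
step).** Let `Φ` be holomorphic on the unit disc, mapping it onto `{z | zᴺ ≠ 1}` as a covering map,
with `Φ(0) = 0` (`N ≥ 1`), and let `z₁ ≠ 0` be a zero of `Φ` in the disc. Then, with `ρ̄ = ‖z₁‖ᴺ`,
`16 ≤ ‖Φ′(0)‖ᴺ · (2 ρ̄ log(1/ρ̄)/(1 − ρ̄²))`.
Proof: lift the competitor `F` of `exists_competitor_compl_rootsOfUnity` through `Φ` (`Φ ∘ ω = F`,
`ω(0) = 0`); `ωᴺ = tᴺ (dslope ω 0)ᴺ` is a self-map of the disc omitting `z₁ᴺ` (by the rotation symmetry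
`Φ(ζ z) = ζ Φ(z)` and `F⁻¹(0) = {0}`); apply the order-`N` punctured-disc Schwarz lemma and
`Φ′(0) ω′(0) = 16^{1/N}`. [cite: CalegariDimitrovTang2025, Theorem 5.1.4 and Lemma 5.1.3] -/
theorem sixteen_le_pow_norm_deriv_mul_of_zero {N : ℕ} (hN : 0 < N) {Φ : ℂ → ℂ}
    (hΦ : DifferentiableOn ℂ Φ (ball (0 : ℂ) 1)) (hΦU : MapsTo Φ (ball (0 : ℂ) 1) {z : ℂ | z ^ N ≠ 1})
    (hcov : IsCoveringMap hΦU.restrict) (hΦ0 : Φ 0 = 0) {z₁ : ℂ} (hz₁ : z₁ ∈ ball (0 : ℂ) 1)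
    (hz₁0 : z₁ ≠ 0) (hΦz₁ : Φ z₁ = 0) :
    (16 : ℝ) ≤ ‖deriv Φ 0‖ ^ N *
      (2 * ‖z₁‖ ^ N * Real.log (‖z₁‖ ^ N)⁻¹ / (1 - (‖z₁‖ ^ N) ^ 2)) := by
  have hb0 : (0 : ℂ) ∈ ball (0 : ℂ) 1 := mem_ball_self one_pos
  obtain ⟨F, hFd, hF0, hF1, hFU, hFz⟩ := exists_competitor_compl_rootsOfUnity hN
  -- the lift `ω`
  obtain ⟨ω, hωd, hωm, hω0, hΦω⟩ :=
    Complex.exists_discLift_of_isCoveringMap hΦ hΦU hcov hFd hFU hb0 (by rw [hΦ0, hF0])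
  -- `Φ′(0) · ω′(0) = 16^{1/N}`
  set r : ℝ := (16 : ℝ) ^ ((N : ℝ)⁻¹) with hr
  have hrpos : 0 < r := by positivity
  have hN0 : (N : ℝ) ≠ 0 := by exact_mod_cast hN.ne'
  have hrN : r ^ N = 16 := by
    rw [hr, ← Real.rpow_natCast, ← Real.rpow_mul (by norm_num), inv_mul_cancel₀ hN0, Real.rpow_one]
  have hderiv : deriv Φ 0 * deriv ω 0 = (r : ℂ) := by
    have hb : ball (0 : ℂ) 1 ∈ 𝓝 (0 : ℂ) := ball_mem_nhds _ one_pos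
    have hev : F =ᶠ[𝓝 0] fun z ↦ Φ (ω z) := by
      filter_upwards [hb] with z hz using (hΦω z hz).symm
    have h1 : DifferentiableAt ℂ ω 0 := hωd.differentiableAt hb
    have h2 : DifferentiableAt ℂ Φ (ω 0) := hΦ.differentiableAt (by rw [hω0]; exact hb)
    have := hev.deriv_eq
    rw [hF1, show (fun z ↦ Φ (ω z)) = Φ ∘ ω from rfl, deriv_comp 0 h2 h1, hω0] at this
    exact this.symm
  -- `H = ωᴺ = tᴺ · qᴺ`, `q = dslope ω 0`
  set q : ℂ → ℂ := dslope ω 0 with hq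
  have hqd : DifferentiableOn ℂ q (ball (0 : ℂ) 1) :=
    (Complex.differentiableOn_dslope (ball_mem_nhds (0 : ℂ) one_pos)).mpr hωd
  have hωq : ∀ t, ω t = t * q t := by
    intro t
    have h := sub_smul_dslope ω 0 t
    rw [sub_zero, hω0, sub_zero, smul_eq_mul] at h
    exact h.symm
  have hfac : ∀ t ∈ ball (0 : ℂ) 1, (fun t ↦ ω t ^ N) t = t ^ N * (fun t ↦ q t ^ N) t := by
    intro t _
    simp only [hωq t, mul_pow]
  have hHd : DifferentiableOn ℂ (fun t ↦ ω t ^ N) (ball (0 : ℂ) 1) := hωd.pow N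
  have hQd : DifferentiableOn ℂ (fun t ↦ q t ^ N) (ball (0 : ℂ) 1) := hqd.pow N
  have hHm : MapsTo (fun t ↦ ω t ^ N) (ball (0 : ℂ) 1) (ball (0 : ℂ) 1) := by
    intro t ht
    have h := hωm ht
    rw [mem_ball, dist_zero_right] at h ⊢
    rw [norm_pow]
    exact pow_lt_one₀ (norm_nonneg _) h hN.ne'
  -- `H` omits `z₁ᴺ`
  have hp0 : z₁ ^ N ≠ 0 := pow_ne_zero _ hz₁0
  have hp1 : ‖z₁ ^ N‖ < 1 := by
    rw [norm_pow]
    exact pow_lt_one₀ (norm_nonneg _) (by simpa using hz₁) hN.ne'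
  have hne : ∀ t ∈ ball (0 : ℂ) 1, ω t ^ N ≠ z₁ ^ N := by
    intro t ht h
    -- `ζ := ω t / z₁` is an `N`-th root of unity with `ω t = ζ z₁`
    set ζ : ℂ := ω t / z₁ with hζ
    have hζN : ζ ^ N = 1 := by rw [hζ, div_pow, h, div_self hp0]
    have hωt : ω t = ζ * z₁ := by rw [hζ, div_mul_cancel₀ _ hz₁0]
    have hΦζ : Φ (ζ * z₁) = ζ * Φ z₁ :=
      apply_mul_eq_mul_apply_of_isCoveringMap_compl_rootsOfUnity hΦ hΦU hcov hΦ0 hζN hz₁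
    have hFt : F t = 0 := by rw [← hΦω t ht, hωt, hΦζ, hΦz₁, mul_zero]
    have ht0 : t = 0 := hFz t ht hFt
    rw [ht0, hω0] at hωt
    have hζ0 : ζ ≠ 0 := by
      intro h0; rw [h0, zero_pow hN.ne'] at hζN; exact zero_ne_one hζN
    exact hz₁0 (by simpa [hζ0] using hωt.symm)
  -- the order-`N` punctured-disc Schwarz lemma
  have hS := norm_le_of_mapsTo_ball_of_forall_ne_of_eq_pow_mul (N := N) hN hHd hQd hfac hHm hp0 hp1
    hne
  -- `q 0 = ω′(0)` and `‖ω′(0)‖ᴺ = 16 / ‖Φ′(0)‖ᴺ`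
  have hq0 : q 0 = deriv ω 0 := by rw [hq, dslope_same]
  simp only [hq0, norm_pow] at hS
  have hΦ'0 : deriv Φ 0 ≠ 0 := Complex.deriv_ne_zero_of_isCoveringMap_ball hΦ hΦU hcov hb0
  have hnorm : ‖deriv Φ 0‖ * ‖deriv ω 0‖ = r := by
    rw [← norm_mul, hderiv, Complex.norm_real, Real.norm_eq_abs, abs_of_pos hrpos]
  have hω' : ‖deriv ω 0‖ = r / ‖deriv Φ 0‖ := by
    rw [eq_div_iff (norm_ne_zero_iff.mpr hΦ'0), mul_comm]; exact hnorm
  rw [hω', div_pow, hrN] at hS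
  have hpos : 0 < ‖deriv Φ 0‖ ^ N := pow_pos (norm_pos_iff.mpr hΦ'0) N
  rw [div_le_iff₀ hpos] at hS
  linarith [hS, mul_comm (2 * ‖z₁‖ ^ N * Real.log (‖z₁‖ ^ N)⁻¹ / (1 - (‖z₁‖ ^ N) ^ 2))
    (‖deriv Φ 0‖ ^ N)]

end Literature.Analysis.Complex

end
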